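import Summits.ValiantsHypothesis.ValiantsHypothesis.Theorems.KPlusLogSqLawWeakLiftingTowerGraftTwoSidedDefiniteAny

/-!
# Tower graft line — THE SHARP EXCHANGE SPLIT: `⌊q/2⌋` corrections, half the constant of the commensurable law

Crux `stmt-ValiantsHypothesis-19561` (`WeakLifting`), line (B) `tower_graft`, two-sided word instrument; seat val-sym-lift-p3 g21,
`--supports 19561`, NO stub claimed.  `…TwoSidedExchangeSplit` splits the exchange certificate `N = Σ_c y_c y_{q−1−c}ᵀ` with `q` rank-one
corrections.  Pairing `c ↔ q−1−c` (`Fin.rev`) does it with `⌊q/2⌋`: `N + Σ_{c < q−1−c} ½ (y_c − y_{q−1−c})(y_c − y_{q−1−c})ᵀ ⪰ 0`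
(`posSemidef_exchange_split_sharp`; quadratic form `Σ_c a_c a_{q−1−c} + ½Σ_{c<q−1−c}(a_c − a_{q−1−c})² = ½Σ_{c<q−1−c}(a_c + a_{q−1−c})² +
Σ_{c = q−1−c} a_c²`, `exchange_quad_nonneg`; `#{c < q−1−c} ≤ q/2`, `card_filter_lt_rev_le`) — the count of negative eigenvalues of the
exchange matrix.  Consequences through the family/abstract machinery of `…TwoSidedSplitFamily` / `…TwoSidedDefiniteAny`:
★ `card_negType_family_le_rank_commensurable_sharp` (entering-type pairs `≤ rank P₀ + Σₗ ⌊qₗ/2⌋·rank Pₗ`) and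
★ `card_posRoots_le_commensurable_sharp` (definite type, any corank: `Z₊ ≤ 2(m + m Σₗ ⌊qₗ/2⌋)`; `(0,1,5,25)` ⇒ `30m`, `(0,1,6,36)` ⇒ `40m`).
HONEST FRAMING: same scope as `…TwoSidedCommensurable` with the constant halved; still growing with the far exponents (not a tower graft
law); nothing on S4…S5, `TowerB`, `WeakLifting` in its window, Conjecture B, 18050 or `VP ≠ VNP`.  Def-free.

[folklore] inertia of the exchange (anti-identity) matrix.
-/

set_option linter.dupNamespace false
set_option autoImplicit false

namespace Summit.ValiantsHypothesis.ValiantsHypothesis.Theorems.KPlusLogSqLaw.TowerGraft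

open Matrix
open scoped BigOperators

namespace TwoSidedThree

/-! ## The SHARP exchange split: `⌊q/2⌋` rank-one corrections (pairing `c ↔ q−1−c`) -/

section SharpExchange

variable {I : Type} [Fintype I] [DecidableEq I]

/-- the pairs `c < q−1−c` of `Fin q`: at most `q/2` of them. [folklore] -/
theorem card_filter_lt_rev_le (q : ℕ) :
    (Finset.univ.filter fun c : Fin q => c < Fin.rev c).card ≤ q / 2 := by
  classical
  set s := Finset.univ.filter fun c : Fin q => c < Fin.rev c with hs
  set t := s.map ⟨Fin.rev, Fin.rev_injective⟩ with ht
  have hdisj : Disjoint s t := by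
    rw [Finset.disjoint_left]
    intro c hc hct
    rw [hs, Finset.mem_filter] at hc
    rw [ht, Finset.mem_map] at hct
    obtain ⟨c', hc', hcc'⟩ := hct
    rw [Finset.mem_filter] at hc'
    have h1 : c' < Fin.rev c' := hc'.2
    simp only [Function.Embedding.coeFn_mk] at hcc'
    rw [← hcc'] at hc
    have h2 : Fin.rev c' < Fin.rev (Fin.rev c') := hc.2
    rw [Fin.rev_rev] at h2
    exact lt_asymm h1 h2
  have hcard : (s ∪ t).card = s.card + s.card := by
    rw [Finset.card_union_of_disjoint hdisj, ht, Finset.card_map]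
  have hle : (s ∪ t).card ≤ q := by
    have := Finset.card_le_univ (s ∪ t)
    rwa [Fintype.card_fin] at this
  omega

omit [DecidableEq I] in
/-- **the exchange quadratic form is nonnegative after `⌊q/2⌋` paired corrections**:
`Σ_c a_c a_{q−1−c} + ½ Σ_{c < q−1−c} (a_c − a_{q−1−c})² = ½ Σ_{c<q−1−c} (a_c + a_{q−1−c})² + Σ_{c = q−1−c} a_c² ≥ 0`. [folklore] -/
theorem exchange_quad_nonneg (q : ℕ) (a : Fin q → ℝ) :
    0 ≤ ∑ c : Fin q, a c * a (Fin.rev c)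
      + ∑ c ∈ Finset.univ.filter (fun c : Fin q => c < Fin.rev c), (1 / 2 : ℝ) * (a c - a (Fin.rev c)) ^ 2 := by
  classical
  set s := Finset.univ.filter fun c : Fin q => c < Fin.rev c with hs
  -- split the full sum by the trichotomy `c < c̄`, `c̄ < c`, `c = c̄`
  have h1 := (Finset.sum_filter_add_sum_filter_not Finset.univ (fun c : Fin q => c < Fin.rev c)
    (fun c => a c * a (Fin.rev c))).symm
  set r := Finset.univ.filter fun c : Fin q => ¬ c < Fin.rev c with hr
  have h2 := (Finset.sum_filter_add_sum_filter_not r (fun c : Fin q => Fin.rev c < c)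
    (fun c => a c * a (Fin.rev c))).symm
  -- the part `c̄ < c` is the image of `s` under `rev`
  have himage : r.filter (fun c : Fin q => Fin.rev c < c) = s.map ⟨Fin.rev, Fin.rev_injective⟩ := by
    ext c
    rw [Finset.mem_filter, hr, Finset.mem_filter, Finset.mem_map]
    constructor
    · rintro ⟨⟨-, _⟩, hlt⟩
      refine ⟨Fin.rev c, ?_, Fin.rev_rev c⟩
      rw [hs, Finset.mem_filter]
      exact ⟨Finset.mem_univ _, by rw [Fin.rev_rev]; exact hlt⟩
    · rintro ⟨c', hc', hcc'⟩
      rw [hs, Finset.mem_filter] at hc'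
      simp only [Function.Embedding.coeFn_mk] at hcc'
      subst hcc'
      rw [Fin.rev_rev]
      exact ⟨⟨Finset.mem_univ _, fun h => lt_asymm hc'.2 h⟩, hc'.2⟩
  have h3 : ∑ c ∈ r.filter (fun c : Fin q => Fin.rev c < c), a c * a (Fin.rev c) = ∑ c ∈ s, a c * a (Fin.rev c) := by
    rw [himage, Finset.sum_map]
    refine Finset.sum_congr rfl fun c _ => ?_
    simp only [Function.Embedding.coeFn_mk, Fin.rev_rev]
    ring
  -- on the fixed points the term is a square
  have h4 : 0 ≤ ∑ c ∈ r.filter (fun c : Fin q => ¬ Fin.rev c < c), a c * a (Fin.rev c) := by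
    refine Finset.sum_nonneg fun c hc => ?_
    rw [Finset.mem_filter, hr, Finset.mem_filter] at hc
    have heq : Fin.rev c = c := le_antisymm (not_lt.mp hc.1.2) (not_lt.mp hc.2)
    rw [heq]; exact mul_self_nonneg _
  have h5 : ∑ c ∈ s, a c * a (Fin.rev c) + ∑ c ∈ s, a c * a (Fin.rev c)
      + ∑ c ∈ s, (1 / 2 : ℝ) * (a c - a (Fin.rev c)) ^ 2 = ∑ c ∈ s, (1 / 2 : ℝ) * (a c + a (Fin.rev c)) ^ 2 := by
    rw [← Finset.sum_add_distrib, ← Finset.sum_add_distrib]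
    exact Finset.sum_congr rfl fun c _ => by ring
  have h6 : 0 ≤ ∑ c ∈ s, (1 / 2 : ℝ) * (a c + a (Fin.rev c)) ^ 2 :=
    Finset.sum_nonneg fun c _ => by positivity
  rw [h1, h2, h3]
  linarith

omit [DecidableEq I] in
/-- `x ⬝ (a bᵀ x) = (a ⬝ x)(b ⬝ x)`. [folklore] -/
theorem dotProduct_vecMulVec_mulVec (a b x : I → ℝ) :
    x ⬝ᵥ (Matrix.vecMulVec a b *ᵥ x) = (a ⬝ᵥ x) * (b ⬝ᵥ x) := by
  simp only [dotProduct, Matrix.mulVec, Matrix.vecMulVec_apply]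
  rw [Finset.sum_mul_sum]
  refine Finset.sum_congr rfl fun i _ => ?_
  rw [Finset.mul_sum]
  exact Finset.sum_congr rfl fun k _ => by ring

omit [Fintype I] [DecidableEq I] in
/-- the exchange certificate as a sum of rank-one matrices. [folklore] -/
theorem exchange_eq_sum_vecMulVec (q : ℕ) (y : Fin q → I → ℝ) :
    (Matrix.of fun i k => ∑ c : Fin q, y c i * y (Fin.rev c) k) = ∑ c : Fin q, Matrix.vecMulVec (y c) (y (Fin.rev c)) := by
  ext i k
  simp only [Matrix.of_apply, Matrix.sum_apply, Matrix.vecMulVec_apply]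

omit [DecidableEq I] in
/-- **the SHARP exchange split**: `[Σ_c y_c(i) y_{q−1−c}(k)] + Σ_{c<q−1−c} ½ (y_c − y_{q−1−c})(y_c − y_{q−1−c})ᵀ` is positive semidefinite
(`⌊q/2⌋` rank-one corrections — the exchange matrix has exactly `⌊q/2⌋` negative eigenvalues). [folklore] -/
theorem posSemidef_exchange_split_sharp (q : ℕ) (y : Fin q → I → ℝ) :
    ((Matrix.of fun i k => ∑ c : Fin q, y c i * y (Fin.rev c) k)
      + ∑ c ∈ Finset.univ.filter (fun c : Fin q => c < Fin.rev c),
          (1 / 2 : ℝ) • Matrix.vecMulVec (y c - y (Fin.rev c)) (y c - y (Fin.rev c))).PosSemidef := by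
  classical
  refine Matrix.PosSemidef.of_dotProduct_mulVec_nonneg ?_ fun x => ?_
  · -- symmetric
    rw [Matrix.IsHermitian, Matrix.conjTranspose_eq_transpose_of_trivial]
    ext i k
    rw [Matrix.transpose_apply, Matrix.add_apply, Matrix.add_apply, Matrix.of_apply, Matrix.of_apply, Matrix.sum_apply,
      Matrix.sum_apply]
    have h1 : ∑ c : Fin q, y c k * y (Fin.rev c) i = ∑ c : Fin q, y c i * y (Fin.rev c) k := by
      rw [← sum_fin_rev_eq (fun c => y c i * y (Fin.rev c) k)]
      simp only [Fin.rev_rev]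
      exact Finset.sum_congr rfl fun c _ => mul_comm _ _
    have h2 : ∑ c ∈ Finset.univ.filter (fun c : Fin q => c < Fin.rev c),
          ((1 / 2 : ℝ) • Matrix.vecMulVec (y c - y (Fin.rev c)) (y c - y (Fin.rev c))) k i
        = ∑ c ∈ Finset.univ.filter (fun c : Fin q => c < Fin.rev c),
          ((1 / 2 : ℝ) • Matrix.vecMulVec (y c - y (Fin.rev c)) (y c - y (Fin.rev c))) i k := by
      refine Finset.sum_congr rfl fun c _ => ?_
      simp only [Matrix.smul_apply, Matrix.vecMulVec_apply, smul_eq_mul]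
      ring
    rw [h1, h2]
  · rw [star_trivial, Matrix.add_mulVec, dotProduct_add]
    -- the quadratic form is `Σ_c a_c a_c̄ + ½ Σ_{c<c̄} (a_c − a_c̄)²` with `a_c = y_c ⬝ x`
    have hN : x ⬝ᵥ ((Matrix.of fun i k => ∑ c : Fin q, y c i * y (Fin.rev c) k) *ᵥ x)
        = ∑ c : Fin q, (y c ⬝ᵥ x) * (y (Fin.rev c) ⬝ᵥ x) := by
      rw [exchange_eq_sum_vecMulVec, Matrix.sum_mulVec, dotProduct_sum]
      exact Finset.sum_congr rfl fun c _ => dotProduct_vecMulVec_mulVec _ _ _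
    have hB : x ⬝ᵥ ((∑ c ∈ Finset.univ.filter (fun c : Fin q => c < Fin.rev c),
          (1 / 2 : ℝ) • Matrix.vecMulVec (y c - y (Fin.rev c)) (y c - y (Fin.rev c))) *ᵥ x)
        = ∑ c ∈ Finset.univ.filter (fun c : Fin q => c < Fin.rev c),
            (1 / 2 : ℝ) * ((y c ⬝ᵥ x) - (y (Fin.rev c) ⬝ᵥ x)) ^ 2 := by
      rw [Matrix.sum_mulVec, dotProduct_sum]
      refine Finset.sum_congr rfl fun c _ => ?_
      rw [Matrix.smul_mulVec, dotProduct_smul, smul_eq_mul, dotProduct_vecMulVec_mulVec, sub_dotProduct, sq]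
    rw [hN, hB]
    exact exchange_quad_nonneg q (fun c => y c ⬝ᵥ x)

variable {m L : ℕ}
variable (P₀ J : Matrix (Fin m) (Fin m) ℝ) (P : Fin L → Matrix (Fin m) (Fin m) ℝ) (e : ℕ) (d q : Fin L → ℕ)
  (τ : I → ℝ) (u : I → Fin m → ℝ)

/-- **THE SHARP COMMENSURABLE LAW (families).**  As `card_negType_family_le_rank_commensurable` with the constant HALVED: entering-type
kernel pairs of `P₀ + τ^e J + Σₗ τ^{e(qₗ+1)} Pₗ` number at most `rank P₀ + Σₗ ⌊qₗ/2⌋·rank Pₗ` — the exchange certificate needs only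
`⌊q/2⌋` rank-one corrections (`posSemidef_exchange_split_sharp`), matching the inertia of the exchange matrix. [folklore] -/
theorem card_negType_family_le_rank_commensurable_sharp (hP₀ : P₀.PosSemidef) (hJ : J.IsSymm)
    (hP : ∀ l, (P l).PosSemidef) (hτ : ∀ i, 0 < τ i) (he : 0 < e) (hq : ∀ l, 1 ≤ q l) (hd : ∀ l, d l = e * (q l + 1))
    (hker : ∀ i, (P₀ + τ i ^ e • J + ∑ l, τ i ^ d l • P l) *ᵥ u i = 0)
    (htype : ∀ i, ∑ l, ((d l - e : ℕ) : ℝ) * τ i ^ d l * (u i ⬝ᵥ (P l *ᵥ u i)) < e * (u i ⬝ᵥ (P₀ *ᵥ u i)))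
    (hsame : ∀ i k, i ≠ k → τ i = τ k →
      (e : ℝ) * (u i ⬝ᵥ (P₀ *ᵥ u k)) = ∑ l, ((d l - e : ℕ) : ℝ) * τ k ^ d l * (u i ⬝ᵥ (P l *ᵥ u k))) :
    Fintype.card I ≤ P₀.rank + ∑ l, (q l / 2) * (P l).rank := by
  classical
  set s : I → ℝ := fun i => τ i ^ e with hs
  set y : (l : Fin L) → Fin (q l) → I → ℝ := fun l c i => s i ^ ((c : ℕ) + 1) with hy
  set N : Fin L → Matrix I I ℝ := fun l => Matrix.of fun i k => ∑ c : Fin (q l), y l c i * y l (Fin.rev c) k with hN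
  have hNent : ∀ l i k, N l i k = s i * s k * ∑ c ∈ Finset.range (q l), s i ^ c * s k ^ (q l - 1 - c) := by
    intro l i k
    simp only [hN, Matrix.of_apply, hy, Fin.val_rev]
    rw [Fin.sum_univ_eq_sum_range (fun c => s i ^ (c + 1) * s k ^ (q l - (c + 1) + 1)) (q l), Finset.mul_sum]
    refine Finset.sum_congr rfl fun c hc => ?_
    have hc' : c < q l := Finset.mem_range.mp hc
    have e1 : q l - (c + 1) + 1 = q l - 1 - c + 1 := by omega
    rw [e1, pow_succ, pow_succ]
    ring
  have htd : ∀ l i, τ i ^ d l = s i ^ (q l + 1) := by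
    intro l i; rw [hd l, pow_mul]
  have hcast : ∀ l, ((d l - e : ℕ) : ℝ) = (e : ℝ) * (q l : ℝ) := by
    intro l
    rw [hd l, show e * (q l + 1) - e = e * q l by rw [Nat.mul_succ, Nat.add_sub_cancel]]
    push_cast; ring
  -- the paired index sets and the rank-one corrections
  set S : (l : Fin L) → Finset (Fin (q l)) := fun l => Finset.univ.filter fun c : Fin (q l) => c < Fin.rev c with hS
  set r : Fin L → ℕ := fun l => (S l).card with hr
  set w : (l : Fin L) → Fin (r l) → I → ℝ := fun l j =>
    Real.sqrt (1 / 2 : ℝ) • (y l ((S l).equivFin.symm j).1 - y l (Fin.rev ((S l).equivFin.symm j).1)) with hw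
  have hsqrt : Real.sqrt (1 / 2 : ℝ) * Real.sqrt (1 / 2 : ℝ) = 1 / 2 :=
    Real.mul_self_sqrt (by norm_num)
  have hwsum : ∀ l, ∑ j, Matrix.vecMulVec (w l j) (w l j)
      = ∑ c ∈ S l, (1 / 2 : ℝ) • Matrix.vecMulVec (y l c - y l (Fin.rev c)) (y l c - y l (Fin.rev c)) := by
    intro l
    have hterm : ∀ v : I → ℝ, Matrix.vecMulVec (Real.sqrt (1 / 2 : ℝ) • v) (Real.sqrt (1 / 2 : ℝ) • v)
        = (1 / 2 : ℝ) • Matrix.vecMulVec v v := by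
      intro v; ext i k
      simp only [Matrix.vecMulVec_apply, Pi.smul_apply, Matrix.smul_apply, smul_eq_mul]
      have e1 : Real.sqrt (1 / 2 : ℝ) * v i * (Real.sqrt (1 / 2 : ℝ) * v k)
          = (Real.sqrt (1 / 2 : ℝ) * Real.sqrt (1 / 2 : ℝ)) * (v i * v k) := by ring
      rw [e1, hsqrt]
    simp only [hw, hterm]
    rw [← Finset.sum_coe_sort (S l)]
    exact Equiv.sum_comp (S l).equivFin.symm
      (fun c : {c // c ∈ S l} => (1 / 2 : ℝ) • Matrix.vecMulVec (y l c.1 - y l (Fin.rev c.1)) (y l c.1 - y l (Fin.rev c.1)))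
  have h := card_negType_le_rank_split_family P₀ J P e d τ u hP₀ hJ hP hτ he hker htype hsame N ?_ ?_ r w
    (fun l => N l + ∑ c ∈ S l, (1 / 2 : ℝ) • Matrix.vecMulVec (y l c - y l (Fin.rev c)) (y l c - y l (Fin.rev c)))
    (fun l => posSemidef_exchange_split_sharp (q l) (y l)) (fun l => by rw [hwsum l])
  · refine h.trans (Nat.add_le_add_left (Finset.sum_le_sum fun l _ => Nat.mul_le_mul_right _ ?_) _)
    exact card_filter_lt_rev_le (q l)
  · intro l i k hik
    have hsik : s i = s k := by simp only [hs, hik]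
    rw [hNent, hsik, geom_sum₂_self, htd, hcast]
    have hq1 : 1 ≤ q l := hq l
    have epow : s k * s k * ((q l : ℝ) * s k ^ (q l - 1)) = (q l : ℝ) * s k ^ (q l + 1) := by
      obtain ⟨r', hr'⟩ := Nat.exists_eq_add_of_le hq1
      rw [hr', Nat.add_sub_cancel_left, pow_add, pow_add, pow_one]; ring
    rw [epow]; ring
  · intro l i k _
    rw [hNent, htd, htd]
    show s i * s k * (∑ c ∈ Finset.range (q l), s i ^ c * s k ^ (q l - 1 - c)) * (s i - s k)
      = s i ^ (q l + 1) * s k - s i * s k ^ (q l + 1)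
    rw [mul_assoc, geom_sum₂_mul, pow_succ, pow_succ]
    ring

end SharpExchange

/-! ## Census: the sharp linear law on commensurable supports (definite type, any corank) -/

section SharpCensus

open Polynomial
open Summit.ValiantsHypothesis.ValiantsHypothesis.Theorems.LacunarySymmetroidMatrixDescartes

variable {m L : ℕ}

/-- **THE SHARP LINEAR LAW ON COMMENSURABLE SUPPORTS (definite type, any corank).**  `P₀ ≻ 0`, `J` ANY symmetric, PSD letters at
`d₀ + e(qₗ+1)` (`qₗ ≥ 1`), a positive definite top letter; definite type at every positive root ⇒
`Z₊ ≤ 2(m + m·Σₗ ⌊qₗ/2⌋)` with multiplicity — half the constant of `card_posRoots_le_commensurable(_of_definite)`; e.g. `(0,1,5,25)`: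
`Z₊ ≤ 2m(1 + 2 + 12) = 30m`, `(0,1,6,36)`: `Z₊ ≤ 2m(1 + 2 + 17) = 40m`.  Still not a tower graft law (constant grows with the far exponents).
[folklore] -/
theorem card_posRoots_le_commensurable_sharp (P₀ J : Matrix (Fin m) (Fin m) ℝ) (P : Fin L → Matrix (Fin m) (Fin m) ℝ)
    (hP₀ : P₀.PosDef) (hJ : J.IsSymm) (hP : ∀ l, (P l).PosSemidef) (l₁ : Fin L) (htop : (P l₁).PosDef)
    (d₀ e : ℕ) (q : Fin L → ℕ) (he : 0 < e) (hq : ∀ l, 1 ≤ q l) (hqtop : ∀ l, l ≠ l₁ → q l < q l₁)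
    (htype : ∀ t : ℝ, 0 < t →
      (∑ k : Fin (L + 2), t ^ (Matrix.vecCons d₀ (Matrix.vecCons (d₀ + e) fun l => d₀ + e * (q l + 1)) k) •
        (Matrix.vecCons P₀ (Matrix.vecCons J P) k)).det = 0 →
      (∀ u : Fin m → ℝ, (∑ k : Fin (L + 2), t ^ (Matrix.vecCons d₀ (Matrix.vecCons (d₀ + e) fun l => d₀ + e * (q l + 1)) k) •
          (Matrix.vecCons P₀ (Matrix.vecCons J P) k)) *ᵥ u = 0 → u ≠ 0 →
        (derivative (∑ k : Fin (L + 2), C (u ⬝ᵥ ((Matrix.vecCons P₀ (Matrix.vecCons J P) k) *ᵥ u)) *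
          (X : ℝ[X]) ^ (Matrix.vecCons d₀ (Matrix.vecCons (d₀ + e) fun l => d₀ + e * (q l + 1)) k))).eval t < 0) ∨
      (∀ u : Fin m → ℝ, (∑ k : Fin (L + 2), t ^ (Matrix.vecCons d₀ (Matrix.vecCons (d₀ + e) fun l => d₀ + e * (q l + 1)) k) •
          (Matrix.vecCons P₀ (Matrix.vecCons J P) k)) *ᵥ u = 0 → u ≠ 0 →
        0 < (derivative (∑ k : Fin (L + 2), C (u ⬝ᵥ ((Matrix.vecCons P₀ (Matrix.vecCons J P) k) *ᵥ u)) *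
          (X : ℝ[X]) ^ (Matrix.vecCons d₀ (Matrix.vecCons (d₀ + e) fun l => d₀ + e * (q l + 1)) k))).eval t)) :
    Multiset.card ((Matrix.det (∑ k : Fin (L + 2),
        ((X : ℝ[X]) ^ (Matrix.vecCons d₀ (Matrix.vecCons (d₀ + e) fun l => d₀ + e * (q l + 1)) k)) •
          (Matrix.vecCons P₀ (Matrix.vecCons J P) k).map C)).roots.filter (fun t => 0 < t))
      ≤ 2 * (m + m * ∑ l, q l / 2) := by
  have hmul : ∀ l, e < e * (q l + 1) := by
    intro l
    have := hq l
    calc e = e * 1 := (Nat.mul_one e).symm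
      _ < e * (q l + 1) := Nat.mul_lt_mul_of_pos_left (by omega) he
  have hmultop : ∀ l, l ≠ l₁ → e * (q l + 1) < e * (q l₁ + 1) :=
    fun l hl => Nat.mul_lt_mul_of_pos_left (by have := hqtop l hl; omega) he
  have h := card_posRoots_le_of_negType_family_law P₀ J P hP₀ hJ hP l₁ htop d₀ e (fun l => e * (q l + 1)) he hmul hmultop
    (P₀.rank + ∑ l, (q l / 2) * (P l).rank)
    (fun I _ _ τ u hτ hker hty hsame =>
      card_negType_family_le_rank_commensurable_sharp P₀ J P e (fun l => e * (q l + 1)) q τ u hP₀.posSemidef hJ hP hτ he hq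
        (fun l => rfl) hker hty hsame) htype
  refine h.trans (Nat.mul_le_mul_left 2 (Nat.add_le_add ((Matrix.rank_le_width P₀).trans le_rfl) ?_))
  rw [Finset.mul_sum]
  exact Finset.sum_le_sum fun l _ => by
    calc q l / 2 * (P l).rank ≤ q l / 2 * m := Nat.mul_le_mul_left _ ((Matrix.rank_le_width (P l)).trans le_rfl)
      _ = m * (q l / 2) := Nat.mul_comm _ _

end SharpCensus

end TwoSidedThree

end Summit.ValiantsHypothesis.ValiantsHypothesis.Theorems.KPlusLogSqLaw.TowerGraft
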